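import Summits.MatrixMultiplication.MatrixMultiplication.Theses.DefinableSTPPDichotomy
import Summits.MatrixMultiplication.MatrixMultiplication.Theorems.PairwiseCurvedTilingsLC.Negative.LonelyTranslates
import Summits.MatrixMultiplication.MatrixMultiplication.Theorems.PairwiseCurvedTilingsLC.Negative.UniformEta
import Summits.MatrixMultiplication.MatrixMultiplication.Theorems.PairwiseCurvedTilingsLC.Negative.PairwiseCurvedTilingsLCThinBlocks
import Summits.MatrixMultiplication.MatrixMultiplication.Theorems.PairwiseCurvedTilingsLC.Negative.PairwiseCurvedTilingsLCFalseOfDefinableTranslateRecurrenceLC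

/-!
# STRATEGY CENSUS (Lean side) — crux `PairwiseCurvedTilingsLC` (stmt-MatrixMultiplication-17883)

crux-strategist seat `planner-cstrat-stmt-MatrixMultiplication-17883-0`, 2026-08-17.
Companion of `STRATEGY-CENSUS.md`: the typed objects the census refers to.

* §1 Strengthen — `GradedLC` (ideator 3's `GradedPairwiseTilingsLC`, re-typed here) with
  `gradedLC_imp : GradedLC → PairwiseCurvedTilingsLC` (proved); `PolynomialTilesLC` (unirational
  tiles; signature only).  Both inherit the refutation of `PairwiseCurvedTilingsLC`.
* §2 Decomposition — the pore-set split `PorosityCriterion` (combinatorial, true) and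
  `PorousDefinablePackingLC` (existence = the whole crux) with the glue
  `LC_of_subs : PorosityCriterion → PorousDefinablePackingLC → PairwiseCurvedTilingsLC` (proved).
* §3 Negation — the landed theorems, `#check`ed by name.
* §4 Route fate — `hexagonClearanceR_of_notLC : ¬ PairwiseCurvedTilingsLC → HexagonClearanceR`
  (proved): once the dodge is refuted the seam is vacuously TRUE, so the route ends
  `refuted:PairwiseCurvedTilingsLC`, not by a seam repair.
-/

set_option linter.dupNamespace false

namespace Summit.MatrixMultiplication.MatrixMultiplication.Cruxes.PairwiseCurvedTilingsLC.StrategyCensus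

open Finset
open scoped Pointwise
open Summit.MatrixMultiplication.MatrixMultiplication.Theses.DefinableSTPPDichotomy
open Summit.MatrixMultiplication.MatrixMultiplication.Theorems.PairwiseCurvedTilingsLC.Negative

/-! ## §1 STRENGTHEN -/

/-- `S⁺₁ = GradedLC`: the crux with one more conjunct on the witness — a non-zero linear functional
`ξ` on `F^m` that is constant on every colour class of every block (blocks lie in parallel affine
hyperplanes; ideator 3's `GradedPairwiseTilingsLC`). -/
def GradedLC : Prop :=
  ∃ (e m k : ℕ) (φI : FirstOrder.Language.ring.Formula (Fin e ⊕ Fin k))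
    (φA φB φC : FirstOrder.Language.ring.Formula ((Fin e ⊕ Fin m) ⊕ Fin k)),
    ∀ ε : ℝ, 0 < ε → ∃ η : ℝ, 0 < η ∧ ∀ q₀ : ℕ, ∃ (F : Type) (_ : Field F) (_ : Fintype F)
      (_ : FirstOrder.Ring.CompatibleRing F), q₀ ≤ ringChar F ∧ ∃ (y : Fin k → F)
      (I : Finset (Fin e → F)) (A B C : (Fin e → F) → Finset (Fin m → F)),
      (∀ x, x ∈ I ↔ φI.Realize (Sum.elim x y)) ∧
      (∀ x v, v ∈ A x ↔ φA.Realize (Sum.elim (Sum.elim x v) y)) ∧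
      (∀ x v, v ∈ B x ↔ φB.Realize (Sum.elim (Sum.elim x v) y)) ∧
      (∀ x v, v ∈ C x ↔ φC.Realize (Sum.elim (Sum.elim x v) y)) ∧
      (∀ i ∈ I, ∀ j ∈ I, ∀ k ∈ I, (i = j ∨ j = k ∨ k = i) → ∀ s ∈ A k, ∀ s' ∈ A i,
        ∀ t ∈ B i, ∀ t' ∈ B j, ∀ u ∈ C j, ∀ u' ∈ C k,
        (s' - s) + (t' - t) + (u' - u) = 0 → i = j ∧ j = k ∧ s = s' ∧ t = t' ∧ u = u') ∧
      (Fintype.card F : ℝ) ^ ((m : ℝ) + η) ≤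
        ∑ x ∈ I, (((A x).card * (B x).card * (C x).card : ℕ) : ℝ) ^ ((2 + ε) / 3) ∧
      ∃ ξ : (Fin m → F) →ₗ[F] F, ξ ≠ 0 ∧ ∀ x ∈ I,
        (∀ v ∈ A x, ∀ w ∈ A x, ξ v = ξ w) ∧ (∀ v ∈ B x, ∀ w ∈ B x, ξ v = ξ w) ∧
        (∀ v ∈ C x, ∀ w ∈ C x, ξ v = ξ w)

/-- `S⁺₁ → S` (projection). -/
theorem gradedLC_imp : GradedLC → PairwiseCurvedTilingsLC := by
  rintro ⟨e, m, k, φI, φA, φB, φC, h⟩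
  refine ⟨e, m, k, φI, φA, φB, φC, fun ε hε => ?_⟩
  obtain ⟨η, hη, hall⟩ := h ε hε
  refine ⟨η, hη, fun q₀ => ?_⟩
  obtain ⟨F, iF, iFin, iCR, hq, y, I, A, B, C, hI, hA, hB, hC, hpair, hmass, -⟩ := hall q₀
  exact ⟨F, iF, iFin, iCR, hq, y, I, A, B, C, hI, hA, hB, hC, hpair, hmass⟩

/-- `S⁺₂ = PolynomialTilesLC` (unirational tiles): labels `x ∈ F^e` (all of them), and each colour
class the image of a polynomial map `F^d → F^m` with integer coefficients in `(x, v, y)` of fixed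
degree — the most rigid sub-class of definable tiles (Weil bounds apply to the parametrisations
directly, no CDM needed).  Signature only; `S⁺₂ → S` holds because polynomial images are
definable (`w ∈ A_x ↔ ∃ v, w = P_A(x, v, y)`). -/
def PolynomialTilesLC : Prop :=
  ∃ (e m d k : ℕ) (PA PB PC : Fin m → MvPolynomial ((Fin e ⊕ Fin d) ⊕ Fin k) ℤ),
    ∀ ε : ℝ, 0 < ε → ∃ η : ℝ, 0 < η ∧ ∀ q₀ : ℕ, ∃ (F : Type) (_ : Field F) (_ : Fintype F)
      (_ : DecidableEq F), q₀ ≤ ringChar F ∧ ∃ (y : Fin k → F),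
      let A : (Fin e → F) → Finset (Fin m → F) := fun x =>
        Finset.univ.image fun v : Fin d → F => fun i => MvPolynomial.aeval (Sum.elim (Sum.elim x v) y) (PA i)
      let B : (Fin e → F) → Finset (Fin m → F) := fun x =>
        Finset.univ.image fun v : Fin d → F => fun i => MvPolynomial.aeval (Sum.elim (Sum.elim x v) y) (PB i)
      let C : (Fin e → F) → Finset (Fin m → F) := fun x =>
        Finset.univ.image fun v : Fin d → F => fun i => MvPolynomial.aeval (Sum.elim (Sum.elim x v) y) (PC i)
      (∀ i j k : Fin e → F, (i = j ∨ j = k ∨ k = i) → ∀ s ∈ A k, ∀ s' ∈ A i,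
        ∀ t ∈ B i, ∀ t' ∈ B j, ∀ u ∈ C j, ∀ u' ∈ C k,
        (s' - s) + (t' - t) + (u' - u) = 0 → i = j ∧ j = k ∧ s = s' ∧ t = t' ∧ u = u') ∧
      (Fintype.card F : ℝ) ^ ((m : ℝ) + η) ≤
        ∑ x : Fin e → F, (((A x).card * (B x).card * (C x).card : ℕ) : ℝ) ^ ((2 + ε) / 3)

/-- `S⁺₃` (uniform `η`) and `S⁺₄` (thin blocks) are REFUTED outright in the tree: -/
example := @not_PairwiseCurvedTilingsLC_uniformEta
example := @Summit.MatrixMultiplication.MatrixMultiplication.Theorems.PairwiseCurvedTilingsLC.Negative.not_PairwiseCurvedTilingsLC_thinBlocks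

/-! ## §2 DECOMPOSITION — the pore-set split -/

/-- `Sub₁ = PorosityCriterion` (combinatorics, TRUE, M-sized): in any abelian group the pairwise
(≥ 2 equal labels) clause is equivalent to block TPP plus, for each of the three colour pairings,
the statement that the SPILL of block `i` (its shadow translated by the inner differences of the
third class) misses the shadow of every other block `k` (the `0` inner difference gives the
packing, the non-zero ones the porosity). -/
def PorosityCriterion : Prop :=
  ∀ (H : Type) [AddCommGroup H] [DecidableEq H] (ι : Type) (I : Finset ι) (A B C : ι → Finset H),
    PairwiseClause I A B C ↔
      ((∀ i ∈ I, ∀ s ∈ A i, ∀ s' ∈ A i, ∀ t ∈ B i, ∀ t' ∈ B i, ∀ u ∈ C i, ∀ u' ∈ C i,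
          (s' - s) + (t' - t) + (u' - u) = 0 → s = s' ∧ t = t' ∧ u = u') ∧
        (∀ i ∈ I, ∀ k ∈ I, i ≠ k → Disjoint ((A i - C i) + (B i - B i)) (A k - C k)) ∧
        (∀ i ∈ I, ∀ j ∈ I, i ≠ j → Disjoint ((A j - B j) + (C j - C j)) (A i - B i)) ∧
        (∀ i ∈ I, ∀ j ∈ I, i ≠ j → Disjoint ((B i - C i) + (A i - A i)) (B j - C j)))

/-- `Sub₂ = PorousDefinablePackingLC`: the crux with its clause replaced by the right-hand side of
the criterion (block TPP + three porous packings).  THIS PIECE IS THE WHOLE CRUX (same witnesses),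
and its fat blocks contradict `PorosityShadowBound` exactly as the crux's do. -/
def PorousDefinablePackingLC : Prop :=
  ∃ (e m k : ℕ) (φI : FirstOrder.Language.ring.Formula (Fin e ⊕ Fin k))
    (φA φB φC : FirstOrder.Language.ring.Formula ((Fin e ⊕ Fin m) ⊕ Fin k)),
    ∀ ε : ℝ, 0 < ε → ∃ η : ℝ, 0 < η ∧ ∀ q₀ : ℕ, ∃ (F : Type) (_ : Field F) (_ : Fintype F)
      (_ : FirstOrder.Ring.CompatibleRing F) (_ : DecidableEq F), q₀ ≤ ringChar F ∧ ∃ (y : Fin k → F)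
      (I : Finset (Fin e → F)) (A B C : (Fin e → F) → Finset (Fin m → F)),
      (∀ x, x ∈ I ↔ φI.Realize (Sum.elim x y)) ∧
      (∀ x v, v ∈ A x ↔ φA.Realize (Sum.elim (Sum.elim x v) y)) ∧
      (∀ x v, v ∈ B x ↔ φB.Realize (Sum.elim (Sum.elim x v) y)) ∧
      (∀ x v, v ∈ C x ↔ φC.Realize (Sum.elim (Sum.elim x v) y)) ∧
      ((∀ i ∈ I, ∀ s ∈ A i, ∀ s' ∈ A i, ∀ t ∈ B i, ∀ t' ∈ B i, ∀ u ∈ C i, ∀ u' ∈ C i,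
          (s' - s) + (t' - t) + (u' - u) = 0 → s = s' ∧ t = t' ∧ u = u') ∧
        (∀ i ∈ I, ∀ k ∈ I, i ≠ k → Disjoint ((A i - C i) + (B i - B i)) (A k - C k)) ∧
        (∀ i ∈ I, ∀ j ∈ I, i ≠ j → Disjoint ((A j - B j) + (C j - C j)) (A i - B i)) ∧
        (∀ i ∈ I, ∀ j ∈ I, i ≠ j → Disjoint ((B i - C i) + (A i - A i)) (B j - C j))) ∧
      (Fintype.card F : ℝ) ^ ((m : ℝ) + η) ≤
        ∑ x ∈ I, (((A x).card * (B x).card * (C x).card : ℕ) : ℝ) ^ ((2 + ε) / 3)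

/-- The glue of the split (proved): `Sub₁ → Sub₂ → crux`. -/
theorem LC_of_subs : PorosityCriterion → PorousDefinablePackingLC → PairwiseCurvedTilingsLC := by
  rintro hcrit ⟨e, m, k, φI, φA, φB, φC, h⟩
  refine ⟨e, m, k, φI, φA, φB, φC, fun ε hε => ?_⟩
  obtain ⟨η, hη, hall⟩ := h ε hε
  refine ⟨η, hη, fun q₀ => ?_⟩
  obtain ⟨F, iF, iFin, iCR, iDE, hq, y, I, A, B, C, hI, hA, hB, hC, hpor, hmass⟩ := hall q₀
  have hpair : PairwiseClause I A B C := (hcrit (Fin m → F) (Fin e → F) I A B C).2 hpor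
  exact ⟨F, iF, iFin, iCR, hq, y, I, A, B, C, hI, hA, hB, hC, hpair, hmass⟩

/-! ## §3 NEGATION — what is landed (names resolve) -/

#check @PairwiseCurvedTilingsLC_false_of_DefinableTranslateRecurrenceLC
#check @notLC_of_shadowBound
#check @Summit.MatrixMultiplication.MatrixMultiplication.Theorems.PairwiseCurvedTilingsLC.Negative.not_PairwiseCurvedTilingsLC_thinBlocks
#check @not_PairwiseCurvedTilingsLC_uniformEta

/-! ## §4 ROUTE FATE — the seam is vacuous once the dodge is refuted -/

/-- Monotonicity of the mass in the exponent (bases are natural numbers: `0` or `≥ 1`). -/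
theorem mass_mono {ι : Type*} (I : Finset ι) (f : ι → ℕ) {a b : ℝ} (ha : 0 < a) (hab : a ≤ b) :
    ∑ x ∈ I, ((f x : ℕ) : ℝ) ^ a ≤ ∑ x ∈ I, ((f x : ℕ) : ℝ) ^ b := by
  refine Finset.sum_le_sum fun x _ => ?_
  rcases Nat.eq_zero_or_pos (f x) with h0 | hpos
  · rw [h0, Nat.cast_zero, Real.zero_rpow ha.ne', Real.zero_rpow (by linarith : (0:ℝ) < b).ne']
  · exact Real.rpow_le_rpow_of_exponent_le (by exact_mod_cast hpos) hab

/-- **`¬ PairwiseCurvedTilingsLC → HexagonClearanceR`.**  If the dodge is false then, for the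
given formulas, some `ε₁ > 0` admits no pairwise-clean family of mass `≥ |F|^{m+η}` in large
characteristic, for any `η > 0`; since the mass is monotone in the exponent, no family meets the
hypotheses of the seam at any `ε ≤ ε₁`, so the seam holds vacuously with `ε₀ := ε₁`.  Hence the
refutation of the crux settles BOTH open cruxes of the route (LC refuted, R proved-vacuous) and the
route ends `refuted:PairwiseCurvedTilingsLC`; no seam repair is meaningful. -/
theorem hexagonClearanceR_of_notLC (h : ¬ PairwiseCurvedTilingsLC) : HexagonClearanceR := by
  intro e m k φI φA φB φC
  have h' : ¬ ∀ ε : ℝ, 0 < ε → ∃ η : ℝ, 0 < η ∧ ∀ q₀ : ℕ, ∃ (F : Type) (_ : Field F)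
      (_ : Fintype F) (_ : FirstOrder.Ring.CompatibleRing F), q₀ ≤ ringChar F ∧ ∃ (y : Fin k → F)
      (I : Finset (Fin e → F)) (A B C : (Fin e → F) → Finset (Fin m → F)),
      (∀ x, x ∈ I ↔ φI.Realize (Sum.elim x y)) ∧
      (∀ x v, v ∈ A x ↔ φA.Realize (Sum.elim (Sum.elim x v) y)) ∧
      (∀ x v, v ∈ B x ↔ φB.Realize (Sum.elim (Sum.elim x v) y)) ∧
      (∀ x v, v ∈ C x ↔ φC.Realize (Sum.elim (Sum.elim x v) y)) ∧
      (∀ i ∈ I, ∀ j ∈ I, ∀ k ∈ I, (i = j ∨ j = k ∨ k = i) → ∀ s ∈ A k, ∀ s' ∈ A i,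
        ∀ t ∈ B i, ∀ t' ∈ B j, ∀ u ∈ C j, ∀ u' ∈ C k,
        (s' - s) + (t' - t) + (u' - u) = 0 → i = j ∧ j = k ∧ s = s' ∧ t = t' ∧ u = u') ∧
      (Fintype.card F : ℝ) ^ ((m : ℝ) + η) ≤
        ∑ x ∈ I, (((A x).card * (B x).card * (C x).card : ℕ) : ℝ) ^ ((2 + ε) / 3) :=
    fun hh => h ⟨e, m, k, φI, φA, φB, φC, hh⟩
  push Not at h'
  obtain ⟨ε₁, hε₁, hnone⟩ := h'
  refine ⟨ε₁, hε₁, fun ε η hε hεle hη => ?_⟩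
  obtain ⟨q₀, hq₀⟩ := hnone η hη
  refine ⟨q₀, ?_⟩
  intro F instF instFin instCR hchar y I A B C hI hA hB hC hpair hmass
  exfalso
  have hlt := hq₀ F instF instFin instCR hchar y I A B C hI hA hB hC hpair
  have hmono : ∑ x ∈ I, (((A x).card * (B x).card * (C x).card : ℕ) : ℝ) ^ ((2 + ε) / 3) ≤
      ∑ x ∈ I, (((A x).card * (B x).card * (C x).card : ℕ) : ℝ) ^ ((2 + ε₁) / 3) :=
    mass_mono I (fun x => (A x).card * (B x).card * (C x).card) (by linarith) (by linarith)
  exact absurd (hmass.trans hmono) (not_le.2 hlt)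

end Summit.MatrixMultiplication.MatrixMultiplication.Cruxes.PairwiseCurvedTilingsLC.StrategyCensus
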